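/-
Copyright (c) 2026 the pub-hodgecm-mathlib formalisation cell (harness21).  Prover seat hodgecm-mathlib-B-p08 (g41): unit U2G_Census, TIER-2 file paying the three
PROFILE stubs `stub_U2G_dict_transvPlus ∕ stub_U2G_dict_transvMinus ∕ stub_U2G_dict_reg` of `Cruxes/H413/Lines/F0_P3c_DyRamFourFrame_U2G_Census.lean`; 2026-09-03.
-/
import Summits.HodgeConjecture.HodgeConjecture.Theorems.F0P3cDyRamProfilePiecesProps            -- ★ p854742 (B-p08 (g41)): `isLocSmooth_pieceTransvPlus ∕ Minus ∕ Reg`, `pieces_conj_eq`, `coe_mem_unitaryGroupOfForm_over`, `uniformizer_facts`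
import Summits.HodgeConjecture.HodgeConjecture.Theorems.F0P3cDyRamPieceCountDictionaryUnit0    -- ★ p854688 (B-p08 (g41)): brings ★ p854635 (`exists_eigenframe_localRing_of_coe_eq_smul_frameElt` & its eigenframe ∕ centraliser ∕ htr₀-wild imports), ★ `mapGL_stdLattice_eq_iff_mem_glInt`, ★ `isSelfDualLattice_stdLattice_three_of_v`, ★ `mem_localIntegralLevel_iff_of_smul_eq`
import Literature.NumberTheory.Automorphic.UnitaryThreeFourFrameFixedCosetSepDictionary        -- ★ p854712 (B-p08 (g41)): `ncard_fixedBy_quotient_sep_eq_ncard_isVertexLattice_fixed_sep`, `finsum_mem_ite_one_zero_eq_ncard_sep`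
import Literature.NumberTheory.Automorphic.OrbitalIntegralFixedPointWeighted                    -- ★ `classOrbitalIntegral_eq_sum_fixedBy_of_support_subset_of_conj_invariant` (the WEIGHTED fixed-coset unfolding)
import Literature.NumberTheory.Automorphic.LocalRegularOrbitClosed                              -- ★ `isClosed_conjClass_local_of_isRegularElt`
import Literature.NumberTheory.Automorphic.UnitaryUnitOrbitalIntegralFixedPoints                -- ★ `isRegularElt_val_conj`, `finite_fixedBy_quotient_of_isClosed`
import Literature.NumberTheory.Automorphic.UnitaryLatticeTreeFrameChange                       -- ★ `mapGL_inv_mapGL`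
import HarnessLib

/-!
# Crux `H413`, line LH4 «(D-RAM) FOUR-FRAME» road — unit U2G, TIER 2: the census dictionaries of the three PROFILE pieces
# `f_{T+}, f_{T−}, f_reg` (pays `U2G_Census.stub_U2G_dict_transvPlus ∕ _transvMinus ∕ _reg` BY NAME)

Cell `hodgecm-mathlib` (D-0151), FLOOR 0, crux item H413 = `stmt-HodgeConjecture-24833`, route of record `HCCMUnconditional`; squad F0∕P3c∕LH4 (req618), director s1808
ACCELERATION RULING; tier-1 unit U2G_Census (assembler B-p08 (g41); leaf `Cruxes/H413/Lines/F0_P3c_DyRamFourFrame_U2G_Census.lean` ED. 1, 24dcc47e4cfc92fe).  THEOREMS ONLY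
(no `def`, no instance, no notation, no `sorry`); lane `--supports stmt-HodgeConjecture-24833 --as helper` (count-neutral).

WHAT IS PROVED.
* `pieceCountDictionary_of_profile` — THE GENERIC PROFILE DICTIONARY: for ANY piece family of the shape `g = 1_{K ∩ {u | prof (ι_w u − 1)}}` that is locally smooth,
  `K`-supported and `Ad K`-invariant, and ANY lattice-side reading `Qlat` of the profile with the transport clause `prof(x⁻¹Tx − 1) ↔ Qlat (T − 1) (x·𝒪³)` for unitary `x`
  (★ p854719 supplies it for the three profiles), the (D-G)-shaped dictionary `PieceCountDictionary g cnt` holds with `cnt T = #{type-0 vertices M : T·M = M ∧ Qlat (T − 1) M}`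
  and the explicit constant `νG₃(K).toReal`.  PROOF: (1) a type-(1) literal `γ` (place matrix `z·Γ_b`) is regular with compact centraliser (its `E_v`-eigenframe — ★ p854635
  `exists_eigenframe_localRing_of_coe_eq_smul_frameElt`, ★ `isRegularElt_of_eigenframe`, ★ `compactSpace_centralizer_of_eigenframe_of_smul_eq`); (2) the WEIGHTED fixed-coset
  unfolding ★ `classOrbitalIntegral_eq_sum_fixedBy_of_support_subset_of_conj_invariant` on the compact open `K = cmLocalIntegralLevel` gives
  `ν(K) · Σ_{q ∈ Fix_γ(G⧸K)} g(out q⁻¹ γ out q)`; (3) the summand is the indicator of `P u := u ∈ K ∧ prof(ι u − 1)`, so the sum is `#{q ∈ Fix | P(out q⁻¹ γ out q)}`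
  (★ p854712 `finsum_mem_ite_one_zero_eq_ncard_sep`; `Fix` finite by ★ `finite_fixedBy_quotient_of_isClosed`); (4) the predicate dictionary ★ p854712
  `ncard_fixedBy_quotient_sep_eq_ncard_isVertexLattice_fixed_sep` (root `𝒪_w³`, `u ∈ K ↔ ι u·𝒪³ = 𝒪³` ★, type preservation ★ `isVertexLattice_mapGL`, transitivity on
  type-0 vertices = ★ `exists_unitary_mapGL_eq_of_isSelfDualLattice_ramifiedCM`), whose clause `P(x⁻¹γx) ↔ Qlat(ι x·𝒪³)` on fixed cosets is the transport hypothesis at the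
  unitary `ι x` (`ι(x⁻¹γx) = (ι x)⁻¹ ι γ ι x`, `ι` a homomorphism), the `∈ K` conjunct being the fixedness.
* `pieceCountDictionary_transvPlus : PieceCountDictionary pieceTransvPlus cntTransvPlus`, `pieceCountDictionary_transvMinus : PieceCountDictionary pieceTransvMinus
  cntTransvMinus`, `pieceCountDictionary_reg : PieceCountDictionary pieceReg cntReg` — the three U2G profile stubs, each ONE `exact` of the generic dictionary at the
  profile's transport clause ★ p854719 `transvPlus_profile_conj_iff ∕ transvMinus_profile_conj_iff ∕ reg_profile_conj_iff` and the piece facts ★ p854742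
  `isLocSmooth_piece… ∕ pieces_conj_eq` (the selectors agree with the generic shapes by `rfl`).

HONEST LABEL.  Count-neutral; the verdict of record for (D-RAM) stays PRINT [LanglandsShelstad1989 Thm. p. 484 ∕ Rogawski1990 Prop. 4.9.1 (a)] ∕ XL; `HC_CM` is proved only
modulo the 7 printed citations (2 remaining: hLiu418 = `stmt-HodgeConjecture-24832`, h413 = `stmt-HodgeConjecture-24833`) until rung 0 closes.

## References
* [Kottwitz1986BaseChangeUnits] R. E. Kottwitz, *Base change for unit elements of Hecke algebras*, Compositio Math. 60 (1986), §1 pp. 240–241, §3.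
* [Rogawski1990] J. D. Rogawski, *Automorphic Representations of Unitary Groups in Three Variables*, Ann. of Math. Stud. 123 (1990), §4.9 Prop. 4.9.1 (b) p. 55.
* [Laumon1995] G. Laumon, *Cohomology of Drinfeld Modular Varieties I* (1996), Lemma (5.3.2) p. 136.
-/

noncomputable section

namespace Summit.HodgeConjecture.HodgeConjecture.Cruxes.H413.F0P3cDyRamPieceCountDictionaryProfiles

open MeasureTheory Measure NumberField IsDedekindDomain Topology Filter
open Literature.NumberTheory.Automorphic Literature.NumberTheory.Automorphic.UnitaryGroup Literature.NumberTheory.Automorphic.IntegralReduction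
open Literature.NumberTheory.Automorphic.UnitaryLatticeTree Literature.NumberTheory.Automorphic.HermitianLattice
open Literature.NumberTheory.Rogawski1990 Literature.NumberTheory.GaloisRepresentations
open Literature.MeasureTheory.Group (descConj)
open Literature.NumberTheory.Automorphic.UnitaryThreeFourFrame
open Summit.HodgeConjecture.HodgeConjecture.Cruxes.H413.F0P3cDyRamFourFramePieces
open Summit.HodgeConjecture.HodgeConjecture.Cruxes.H413.F0P3cDyRamFourFrameCensusDefs
open Summit.HodgeConjecture.HodgeConjecture.Cruxes.H413.F0P3cDyRamProfileLabelTransport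
open Summit.HodgeConjecture.HodgeConjecture.Cruxes.H413.F0P3cDyRamProfilePiecesProps
open Summit.HodgeConjecture.HodgeConjecture.Cruxes.H413.F0P3cDyRamAnchorCountDictionaryZero
open scoped Valued WithZero Matrix MatrixGroups Classical

/-! ## §0  A finsum reading (private) -/

/-- `Σᶠ_{q ∈ s} F q = #{q ∈ s | p q}` for a FINITE `s` when `F = 1` on `p` and `0` off `p` (★ p854712 `finsum_mem_ite_one_zero_eq_ncard_sep`, `if`-free form).
[cite: Laumon1995, Lemma (5.3.2) p. 136] -/
private theorem finsum_mem_eq_ncard_sep_of {α : Type*} (s : Set α) (hs : s.Finite) (F : α → ℂ) (p : α → Prop)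
    (h1 : ∀ q, p q → F q = 1) (h0 : ∀ q, ¬ p q → F q = 0) :
    ∑ᶠ q ∈ s, F q = (({q | q ∈ s ∧ p q} : Set α).ncard : ℂ) := by
  rw [← finsum_mem_ite_one_zero_eq_ncard_sep s hs p]
  refine finsum_mem_congr rfl fun q _ => ?_
  by_cases hq : p q
  · rw [if_pos hq, h1 q hq]
  · rw [if_neg hq, h0 q hq]

/-! ## §1  The generic profile dictionary -/

set_option maxHeartbeats 400000 in
/-- **THE GENERIC PROFILE DICTIONARY.**  For a piece family `g` with `g_w = 1_{K ∩ {u | prof (ι_w u − 1)}}` (hypothesis `hg`) that is locally smooth and `K`-supported (`hsm`)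
and `Ad K`-invariant (`hinv`) at every uniformiser, a count family `cnt` with `cnt T = #{type-0 vertices M : T·M = M ∧ Qlat (T − 1) M}` (`hcnt`), and the transport clause
`prof (x⁻¹Tx − 1) ↔ Qlat (T − 1) (x·𝒪³)` for unitary `x` (`hprof`): `PieceCountDictionary g cnt` — at every wild ramified non-split place and every type-(1) literal `γ`,
`Φ(⟦γ⟧, g_w; mG₃) = νG₃(K).toReal · cnt (ι_w γ)`.
[cite: Kottwitz1986BaseChangeUnits, §1 pp. 240–241, §3] [cite: Rogawski1990, §4.9 Prop. 4.9.1 (b) p. 55] [cite: Laumon1995, Lemma (5.3.2) p. 136] -/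
theorem pieceCountDictionary_of_profile (prof : (∀ (L : Type) [Field L] [NumberField L] [IsCMField L] (v : HeightOneSpectrum (𝓞 ↥(maximalRealSubfield L))) (w : UnitaryGroup.PlacesOver L v), IsCMField.complexConj L • w.1 = w.1 → w.1.adicCompletion L → Matrix (Fin 3) (Fin 3) (w.1.adicCompletion L) → Prop))
    (Qlat : (∀ (L : Type) [Field L] [NumberField L] [IsCMField L] (v : HeightOneSpectrum (𝓞 ↥(maximalRealSubfield L))) (w : UnitaryGroup.PlacesOver L v), IsCMField.complexConj L • w.1 = w.1 → w.1.adicCompletion L → Matrix (Fin 3) (Fin 3) (w.1.adicCompletion L) →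
      Submodule 𝒪[w.1.adicCompletion L] (Fin 3 → w.1.adicCompletion L) → Prop))
    (g : (∀ (L : Type) [Field L] [NumberField L] [IsCMField L] (v : HeightOneSpectrum (𝓞 ↥(maximalRealSubfield L))) (w : UnitaryGroup.PlacesOver L v), IsCMField.complexConj L • w.1 = w.1 → w.1.adicCompletion L → ((UnitaryGroup.cmDatum L 3 (Matrix.of fun i j : Fin 3 => if i.val + j.val + 1 = 3 then (1 : L) else 0)).Local v) → ℂ))
    (cnt : (∀ (L : Type) [Field L] [NumberField L] [IsCMField L] (v : HeightOneSpectrum (𝓞 ↥(maximalRealSubfield L))) (w : UnitaryGroup.PlacesOver L v), IsCMField.complexConj L • w.1 = w.1 → w.1.adicCompletion L → GL (Fin 3) (w.1.adicCompletion L) → ℕ))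
    (hg : ∀ (L : Type) [Field L] [NumberField L] [IsCMField L] (v : HeightOneSpectrum (𝓞 ↥(maximalRealSubfield L))) (w : UnitaryGroup.PlacesOver L v)
      (hw : IsCMField.complexConj L • w.1 = w.1) (ϖ : w.1.adicCompletion L),
      g L v w hw ϖ = Set.indicator {u : ((UnitaryGroup.cmDatum L 3 (Matrix.of fun i j : Fin 3 => if i.val + j.val + 1 = 3 then (1 : L) else 0)).Local v) | u ∈ (cmLocalIntegralLevel L 3 (Matrix.of fun i j : Fin 3 => if i.val + j.val + 1 = 3 then (1 : L) else 0) v) ∧ prof L v w hw ϖ (wMatrix L w hw u - 1)} (fun _ => (1 : ℂ)))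
    (hcnt : ∀ (L : Type) [Field L] [NumberField L] [IsCMField L] (v : HeightOneSpectrum (𝓞 ↥(maximalRealSubfield L))) (w : UnitaryGroup.PlacesOver L v)
      (hw : IsCMField.complexConj L • w.1 = w.1) (ϖ : w.1.adicCompletion L) (T : GL (Fin 3) (w.1.adicCompletion L)),
      cnt L v w hw ϖ T = {M : Submodule 𝒪[w.1.adicCompletion L] (Fin 3 → w.1.adicCompletion L) |
        IsVertexLattice (galAdicCompletionMap (L := L) (IsCMField.complexConj L) hw) ϖ ((StdForm.antidiagonal 3).over (w.1.adicCompletion L)) 0 M ∧ mapGL T M = M ∧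
          Qlat L v w hw ϖ ((T : Matrix (Fin 3) (Fin 3) (w.1.adicCompletion L)) - 1) M}.ncard)
    (hsm : ∀ (L : Type) [Field L] [NumberField L] [IsCMField L] (v : HeightOneSpectrum (𝓞 ↥(maximalRealSubfield L))) (w : UnitaryGroup.PlacesOver L v)
      (hw : IsCMField.complexConj L • w.1 = w.1) (ϖ : w.1.adicCompletion L), Valued.v ϖ = WithZero.exp (-1 : ℤ) →
      IsLocSmooth (g L v w hw ϖ) ∧ tsupport (g L v w hw ϖ) ⊆ ((cmLocalIntegralLevel L 3 (Matrix.of fun i j : Fin 3 => if i.val + j.val + 1 = 3 then (1 : L) else 0) v) : Set ((UnitaryGroup.cmDatum L 3 (Matrix.of fun i j : Fin 3 => if i.val + j.val + 1 = 3 then (1 : L) else 0)).Local v)))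
    (hinv : ∀ (L : Type) [Field L] [NumberField L] [IsCMField L] (v : HeightOneSpectrum (𝓞 ↥(maximalRealSubfield L))) (w : UnitaryGroup.PlacesOver L v)
      (hw : IsCMField.complexConj L • w.1 = w.1) (ϖ : w.1.adicCompletion L), Valued.v ϖ = WithZero.exp (-1 : ℤ) →
      ∀ ⦃k : ((UnitaryGroup.cmDatum L 3 (Matrix.of fun i j : Fin 3 => if i.val + j.val + 1 = 3 then (1 : L) else 0)).Local v)⦄, k ∈ (cmLocalIntegralLevel L 3 (Matrix.of fun i j : Fin 3 => if i.val + j.val + 1 = 3 then (1 : L) else 0) v) → ∀ x : ((UnitaryGroup.cmDatum L 3 (Matrix.of fun i j : Fin 3 => if i.val + j.val + 1 = 3 then (1 : L) else 0)).Local v), g L v w hw ϖ (k * x * k⁻¹) = g L v w hw ϖ x)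
    (hprof : ∀ (L : Type) [Field L] [NumberField L] [IsCMField L] (v : HeightOneSpectrum (𝓞 ↥(maximalRealSubfield L))) (w : UnitaryGroup.PlacesOver L v)
      (hw : IsCMField.complexConj L • w.1 = w.1) (ϖ : w.1.adicCompletion L), ϖ ≠ 0 → ∀ (T : Matrix (Fin 3) (Fin 3) (w.1.adicCompletion L)) ⦃x : GL (Fin 3) (w.1.adicCompletion L)⦄,
      x ∈ unitaryGroupOfForm (galAdicCompletionMap (L := L) (IsCMField.complexConj L) hw) ((StdForm.antidiagonal 3).over (w.1.adicCompletion L)) →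
        (prof L v w hw ϖ ((x : Matrix (Fin 3) (Fin 3) (w.1.adicCompletion L))⁻¹ * T * (x : Matrix (Fin 3) (Fin 3) (w.1.adicCompletion L)) - 1) ↔
          Qlat L v w hw ϖ (T - 1) (mapGL x (stdLattice (w.1.adicCompletion L) 3)))) :
    PieceCountDictionary g cnt := by
  intro L _ _ _ v w hw he _h2 ϖ hϖ _ _ _ _ νG₃ _ _ mG₃ hcan f hf α β z hα hβ hz hαβ hα1 hβ1 b Γ hΓ γ hγ
  have hc1 : IsCMField.complexConj L ≠ 1 := IsCMField.complexConj_ne_one L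
  have hpf : placeForm (Matrix.of fun i j : Fin 3 => if i.val + j.val + 1 = 3 then (1 : L) else 0) w.1 = (StdForm.antidiagonal 3).over (w.1.adicCompletion L) := placeForm_antidiagThree_eq_over L w
  have hH : (((Matrix.of fun i j : Fin 3 => if i.val + j.val + 1 = 3 then (1 : L) else 0)).map (cmConjRingHom L))ᵀ = (Matrix.of fun i j : Fin 3 => if i.val + j.val + 1 = 3 then (1 : L) else 0) := antidiagOne_isHermitian L 3
  have hdet : ((Matrix.of fun i j : Fin 3 => if i.val + j.val + 1 = 3 then (1 : L) else 0)).det ≠ 0 := (isUnit_antidiagOne_det L 3).ne_zero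
  have hϖ0 : ϖ ≠ 0 := (uniformizer_facts L w hϖ).1
  -- (1) `γ` is regular with compact centraliser (its `E_v`-eigenframe)
  obtain ⟨Q, uu, hQ, hu, hu1⟩ := exists_eigenframe_localRing_of_coe_eq_smul_frameElt L w hw γ hf hα hβ hz hαβ hα1 hβ1 b hΓ hγ
  have hreg : IsRegularElt (γ.val : GL (Fin 3) (UnitaryGroup.LocalRing L v)) := isRegularElt_of_eigenframe L (Matrix.of fun i j : Fin 3 => if i.val + j.val + 1 = 3 then (1 : L) else 0) w hw γ hQ hu
  haveI : CompactSpace (Subgroup.centralizer ({γ} : Set ((UnitaryGroup.cmDatum L 3 (Matrix.of fun i j : Fin 3 => if i.val + j.val + 1 = 3 then (1 : L) else 0)).Local v))) :=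
    compactSpace_centralizer_of_eigenframe_of_smul_eq L w hw (Matrix.of fun i j : Fin 3 => if i.val + j.val + 1 = 3 then (1 : L) else 0) hH hdet γ hQ hu hu1
  obtain ⟨hKc, hKo⟩ := isCompact_isOpen_cmLocalIntegralLevel L 3 (Matrix.of fun i j : Fin 3 => if i.val + j.val + 1 = 3 then (1 : L) else 0) v
  have hO := isClosed_conjClass_local_of_isRegularElt L 3 (Matrix.of fun i j : Fin 3 => if i.val + j.val + 1 = 3 then (1 : L) else 0) v hH hdet γ hreg
  -- (2) the weighted fixed-coset unfolding on `K`
  obtain ⟨hsm', hts'⟩ := hsm L v w hw ϖ hϖ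
  rw [classOrbitalIntegral_eq_sum_fixedBy_of_support_subset_of_conj_invariant
    (P := fun γ : ((UnitaryGroup.cmDatum L 3 (Matrix.of fun i j : Fin 3 => if i.val + j.val + 1 = 3 then (1 : L) else 0)).Local v) => IsRegularElt (γ.val : GL (Fin 3) (UnitaryGroup.LocalRing L v)))
    (fun g' x hg' => isRegularElt_val_conj L 3 (Matrix.of fun i j : Fin 3 => if i.val + j.val + 1 = 3 then (1 : L) else 0) v g' x hg') hcan hreg (cmLocalIntegralLevel L 3 (Matrix.of fun i j : Fin 3 => if i.val + j.val + 1 = 3 then (1 : L) else 0) v) hKo hKc hO (g L v w hw ϖ) hsm'.continuous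
    ((subset_tsupport _).trans hts') (fun k hk x => hinv L v w hw ϖ hϖ hk x)]
  -- (3) the summand is `1` iff `out q⁻¹ γ out q ∈ K ∧ prof (ι(out q⁻¹ γ out q) − 1)`: the sum is a separated count of fixed cosets
  have hfin : (MulAction.fixedBy (((UnitaryGroup.cmDatum L 3 (Matrix.of fun i j : Fin 3 => if i.val + j.val + 1 = 3 then (1 : L) else 0)).Local v) ⧸ (cmLocalIntegralLevel L 3 (Matrix.of fun i j : Fin 3 => if i.val + j.val + 1 = 3 then (1 : L) else 0) v)) γ).Finite := finite_fixedBy_quotient_of_isClosed γ (cmLocalIntegralLevel L 3 (Matrix.of fun i j : Fin 3 => if i.val + j.val + 1 = 3 then (1 : L) else 0) v) hO hKo hKc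
  rw [finsum_mem_eq_ncard_sep_of _ hfin (fun q : ((UnitaryGroup.cmDatum L 3 (Matrix.of fun i j : Fin 3 => if i.val + j.val + 1 = 3 then (1 : L) else 0)).Local v) ⧸ (cmLocalIntegralLevel L 3 (Matrix.of fun i j : Fin 3 => if i.val + j.val + 1 = 3 then (1 : L) else 0) v) => g L v w hw ϖ (q.out⁻¹ * γ * q.out))
    (fun q : ((UnitaryGroup.cmDatum L 3 (Matrix.of fun i j : Fin 3 => if i.val + j.val + 1 = 3 then (1 : L) else 0)).Local v) ⧸ (cmLocalIntegralLevel L 3 (Matrix.of fun i j : Fin 3 => if i.val + j.val + 1 = 3 then (1 : L) else 0) v) => q.out⁻¹ * γ * q.out ∈ (cmLocalIntegralLevel L 3 (Matrix.of fun i j : Fin 3 => if i.val + j.val + 1 = 3 then (1 : L) else 0) v) ∧ prof L v w hw ϖ (wMatrix L w hw (q.out⁻¹ * γ * q.out) - 1))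
    (fun q hq => by
      show g L v w hw ϖ (q.out⁻¹ * γ * q.out) = 1
      rw [hg L v w hw ϖ]
      exact Set.indicator_of_mem (s := {u : ((UnitaryGroup.cmDatum L 3 (Matrix.of fun i j : Fin 3 => if i.val + j.val + 1 = 3 then (1 : L) else 0)).Local v) | u ∈ (cmLocalIntegralLevel L 3 (Matrix.of fun i j : Fin 3 => if i.val + j.val + 1 = 3 then (1 : L) else 0) v) ∧ prof L v w hw ϖ (wMatrix L w hw u - 1)}) hq _)
    (fun q hq => by
      show g L v w hw ϖ (q.out⁻¹ * γ * q.out) = 0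
      rw [hg L v w hw ϖ]
      exact Set.indicator_of_notMem (s := {u : ((UnitaryGroup.cmDatum L 3 (Matrix.of fun i j : Fin 3 => if i.val + j.val + 1 = 3 then (1 : L) else 0)).Local v) | u ∈ (cmLocalIntegralLevel L 3 (Matrix.of fun i j : Fin 3 => if i.val + j.val + 1 = 3 then (1 : L) else 0) v) ∧ prof L v w hw ϖ (wMatrix L w hw u - 1)}) hq _)]
  -- (4) the labelled coset count = the labelled fixed-vertex count
  let ι : ((UnitaryGroup.cmDatum L 3 (Matrix.of fun i j : Fin 3 => if i.val + j.val + 1 = 3 then (1 : L) else 0)).Local v) →* GL (Fin 3) (w.1.adicCompletion L) :=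
    (Subgroup.subtype _).comp (localNonsplitEquiv (IsCMField.complexConj L) (Matrix.of fun i j : Fin 3 => if i.val + j.val + 1 = 3 then (1 : L) else 0) hc1 w hw).toMulEquiv.toMonoidHom
  have hιe : ∀ u, ι u = ((localNonsplitEquiv (IsCMField.complexConj L) (Matrix.of fun i j : Fin 3 => if i.val + j.val + 1 = 3 then (1 : L) else 0) (IsCMField.complexConj_ne_one L) w hw u :
        ↥(unitaryGroupOfForm (galAdicCompletionMap (L := L) (IsCMField.complexConj L) hw) (placeForm (Matrix.of fun i j : Fin 3 => if i.val + j.val + 1 = 3 then (1 : L) else 0) w.1))) : GL (Fin 3) (w.1.adicCompletion L)) := fun _ => rfl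
  have hN : IsVertexLattice (galAdicCompletionMap (L := L) (IsCMField.complexConj L) hw) ϖ ((StdForm.antidiagonal 3).over (w.1.adicCompletion L)) 0 (stdLattice (w.1.adicCompletion L) 3) :=
    isSelfDualLattice_stdLattice_three_of_v hϖ
  have hKt : ∀ u : ((UnitaryGroup.cmDatum L 3 (Matrix.of fun i j : Fin 3 => if i.val + j.val + 1 = 3 then (1 : L) else 0)).Local v), u ∈ (cmLocalIntegralLevel L 3 (Matrix.of fun i j : Fin 3 => if i.val + j.val + 1 = 3 then (1 : L) else 0) v) ↔ mapGL (ι u) (stdLattice (w.1.adicCompletion L) 3) = stdLattice (w.1.adicCompletion L) 3 := fun u => by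
    rw [hιe]
    exact (mem_localIntegralLevel_iff_of_smul_eq (IsCMField.complexConj L) 3 (Matrix.of fun i j : Fin 3 => if i.val + j.val + 1 = 3 then (1 : L) else 0) hc1 w hw u).trans (mapGL_stdLattice_eq_iff_mem_glInt _).symm
  have hxU : ∀ u : ((UnitaryGroup.cmDatum L 3 (Matrix.of fun i j : Fin 3 => if i.val + j.val + 1 = 3 then (1 : L) else 0)).Local v), ι u ∈ unitaryGroupOfForm (galAdicCompletionMap (L := L) (IsCMField.complexConj L) hw) ((StdForm.antidiagonal 3).over (w.1.adicCompletion L)) := fun u => by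
    rw [hιe]; exact coe_mem_unitaryGroupOfForm_over L w hw u
  have htype : ∀ u : ((UnitaryGroup.cmDatum L 3 (Matrix.of fun i j : Fin 3 => if i.val + j.val + 1 = 3 then (1 : L) else 0)).Local v), IsVertexLattice (galAdicCompletionMap (L := L) (IsCMField.complexConj L) hw) ϖ ((StdForm.antidiagonal 3).over (w.1.adicCompletion L)) 0 (mapGL (ι u) (stdLattice (w.1.adicCompletion L) 3)) :=
    fun u => isVertexLattice_mapGL (galAdicCompletionMap (L := L) (IsCMField.complexConj L) hw) ϖ _ (ι u) (hxU u) hN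
  have htr : ∀ M : Submodule 𝒪[w.1.adicCompletion L] (Fin 3 → w.1.adicCompletion L),
      IsVertexLattice (galAdicCompletionMap (L := L) (IsCMField.complexConj L) hw) ϖ ((StdForm.antidiagonal 3).over (w.1.adicCompletion L)) 0 M → ∃ u : ((UnitaryGroup.cmDatum L 3 (Matrix.of fun i j : Fin 3 => if i.val + j.val + 1 = 3 then (1 : L) else 0)).Local v), mapGL (ι u) (stdLattice (w.1.adicCompletion L) 3) = M := by
    intro M hM
    obtain ⟨u₁, hu₁⟩ := exists_unitary_mapGL_eq_of_isSelfDualLattice_ramifiedCM L v w hw he hϖ hN hM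
    have hu₁' : (u₁ : GL (Fin 3) (w.1.adicCompletion L)) ∈ unitaryGroupOfForm (galAdicCompletionMap (L := L) (IsCMField.complexConj L) hw) (placeForm (Matrix.of fun i j : Fin 3 => if i.val + j.val + 1 = 3 then (1 : L) else 0) w.1) := by
      rw [hpf]; exact u₁.2
    refine ⟨(localNonsplitEquiv (IsCMField.complexConj L) (Matrix.of fun i j : Fin 3 => if i.val + j.val + 1 = 3 then (1 : L) else 0) hc1 w hw).symm ⟨(u₁ : GL (Fin 3) (w.1.adicCompletion L)), hu₁'⟩, ?_⟩
    rw [hιe, ContinuousMulEquiv.apply_symm_apply]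
    exact hu₁
  have hPQ : ∀ x : ((UnitaryGroup.cmDatum L 3 (Matrix.of fun i j : Fin 3 => if i.val + j.val + 1 = 3 then (1 : L) else 0)).Local v), mapGL (ι γ) (mapGL (ι x) (stdLattice (w.1.adicCompletion L) 3)) = mapGL (ι x) (stdLattice (w.1.adicCompletion L) 3) →
      ((x⁻¹ * γ * x ∈ (cmLocalIntegralLevel L 3 (Matrix.of fun i j : Fin 3 => if i.val + j.val + 1 = 3 then (1 : L) else 0) v) ∧ prof L v w hw ϖ (wMatrix L w hw (x⁻¹ * γ * x) - 1)) ↔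
        Qlat L v w hw ϖ (((ι γ : GL (Fin 3) (w.1.adicCompletion L)) : Matrix (Fin 3) (Fin 3) (w.1.adicCompletion L)) - 1)
          (mapGL (ι x) (stdLattice (w.1.adicCompletion L) 3))) := by
    intro x hfix
    have hmemK : x⁻¹ * γ * x ∈ (cmLocalIntegralLevel L 3 (Matrix.of fun i j : Fin 3 => if i.val + j.val + 1 = 3 then (1 : L) else 0) v) := by
      rw [hKt, map_mul, map_mul, map_inv, mapGL_mul, mapGL_mul, hfix, mapGL_inv_mapGL]
    have hconj : wMatrix L w hw (x⁻¹ * γ * x) =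
        ((ι x : GL (Fin 3) (w.1.adicCompletion L)) : Matrix (Fin 3) (Fin 3) (w.1.adicCompletion L))⁻¹ *
          ((ι γ : GL (Fin 3) (w.1.adicCompletion L)) : Matrix (Fin 3) (Fin 3) (w.1.adicCompletion L)) *
            ((ι x : GL (Fin 3) (w.1.adicCompletion L)) : Matrix (Fin 3) (Fin 3) (w.1.adicCompletion L)) := by
      show ((ι (x⁻¹ * γ * x) : GL (Fin 3) (w.1.adicCompletion L)) : Matrix (Fin 3) (Fin 3) (w.1.adicCompletion L)) = _
      rw [map_mul, map_mul, map_inv, Units.val_mul, Units.val_mul, Matrix.coe_units_inv]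
    rw [hconj, hprof L v w hw ϖ hϖ0 _ (hxU x)]
    exact ⟨fun h => h.2, fun h => ⟨hmemK, h⟩⟩
  rw [ncard_fixedBy_quotient_sep_eq_ncard_isVertexLattice_fixed_sep ι (stdLattice (w.1.adicCompletion L) 3) (cmLocalIntegralLevel L 3 (Matrix.of fun i j : Fin 3 => if i.val + j.val + 1 = 3 then (1 : L) else 0) v) (galAdicCompletionMap (L := L) (IsCMField.complexConj L) hw) ϖ
      ((StdForm.antidiagonal 3).over (w.1.adicCompletion L)) 0 hKt htype htr γ
      (fun u : ((UnitaryGroup.cmDatum L 3 (Matrix.of fun i j : Fin 3 => if i.val + j.val + 1 = 3 then (1 : L) else 0)).Local v) => u ∈ (cmLocalIntegralLevel L 3 (Matrix.of fun i j : Fin 3 => if i.val + j.val + 1 = 3 then (1 : L) else 0) v) ∧ prof L v w hw ϖ (wMatrix L w hw u - 1))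
      (fun M => Qlat L v w hw ϖ (((ι γ : GL (Fin 3) (w.1.adicCompletion L)) : Matrix (Fin 3) (Fin 3) (w.1.adicCompletion L)) - 1) M) hPQ,
    hcnt, Measure.real, Complex.real_smul]
  -- (5) `ι γ` is the dictionary's `ι_w γ` (`rfl`)
  rfl

/-! ## §2  The three U2G profile stubs -/

/-- **`PieceCountDictionary pieceTransvPlus cntTransvPlus`** (pays `U2G_Census.stub_U2G_dict_transvPlus` BY NAME): at every wild ramified non-split place and every
type-(1) literal `γ`, `Φ(⟦γ⟧, f_{T+}; mG₃) = νG₃(K).toReal · transvPlusFixCount σ_w ϖ d (d % 2) m* (ι_w γ)` — the labelled near-transvection piece counts the type-0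
vertices fixed by `ι_w γ` carrying the vertex-side shell `(d % 2, m*)` and label `+` of `ι_w γ − 1` (`d = dOfPlace`, `m* = mstarFn`).
[cite: Kottwitz1986BaseChangeUnits, §1 pp. 240–241, §3] [cite: Rogawski1990, §4.9 Prop. 4.9.1 (b) p. 55] [cite: Laumon1995, Lemma (5.3.2) p. 136] -/
theorem pieceCountDictionary_transvPlus : PieceCountDictionary pieceTransvPlus cntTransvPlus :=
  pieceCountDictionary_of_profile
    (fun L _ _ _ v w hw ϖ X => NearTransvShell ϖ (dOfPlace L v w % 2) (mstarFn L v w) X ∧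
      LabelPlus (galAdicCompletionMap (L := L) (IsCMField.complexConj L) hw) ϖ (dOfPlace L v w) (mstarFn L v w) X)
    (fun L _ _ _ v w hw ϖ X M => LatticeNearTransvShell ϖ (dOfPlace L v w % 2) (mstarFn L v w) X M ∧
      LatticeLabelPlus (galAdicCompletionMap (L := L) (IsCMField.complexConj L) hw) ϖ (dOfPlace L v w) (mstarFn L v w) M X)
    pieceTransvPlus cntTransvPlus (fun _ _ _ _ _ _ _ _ => rfl) (fun _ _ _ _ _ _ _ _ _ => rfl)
    (fun L _ _ _ _ w hw _ hϖ => isLocSmooth_pieceTransvPlus L w hw hϖ)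
    (fun L _ _ _ _ w hw _ hϖ _ hk x => (pieces_conj_eq L w hw hϖ hk x).1)
    (fun L _ _ _ v w hw _ hϖ0 T _ hx => transvPlus_profile_conj_iff (galAdicCompletionMap (L := L) (IsCMField.complexConj L) hw) hϖ0
      (dOfPlace L v w) (dOfPlace L v w % 2) (mstarFn L v w) T hx)

/-- **`PieceCountDictionary pieceTransvMinus cntTransvMinus`** (pays `U2G_Census.stub_U2G_dict_transvMinus` BY NAME): the same with the label NEGATED —
`Φ(⟦γ⟧, f_{T−}; mG₃) = νG₃(K).toReal · transvMinusFixCount σ_w ϖ d (d % 2) m* (ι_w γ)`.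
[cite: Kottwitz1986BaseChangeUnits, §1 pp. 240–241, §3] [cite: Rogawski1990, §4.9 Prop. 4.9.1 (b) p. 55] [cite: Laumon1995, Lemma (5.3.2) p. 136] -/
theorem pieceCountDictionary_transvMinus : PieceCountDictionary pieceTransvMinus cntTransvMinus :=
  pieceCountDictionary_of_profile
    (fun L _ _ _ v w hw ϖ X => NearTransvShell ϖ (dOfPlace L v w % 2) (mstarFn L v w) X ∧
      ¬ LabelPlus (galAdicCompletionMap (L := L) (IsCMField.complexConj L) hw) ϖ (dOfPlace L v w) (mstarFn L v w) X)
    (fun L _ _ _ v w hw ϖ X M => LatticeNearTransvShell ϖ (dOfPlace L v w % 2) (mstarFn L v w) X M ∧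
      ¬ LatticeLabelPlus (galAdicCompletionMap (L := L) (IsCMField.complexConj L) hw) ϖ (dOfPlace L v w) (mstarFn L v w) M X)
    pieceTransvMinus cntTransvMinus (fun _ _ _ _ _ _ _ _ => rfl) (fun _ _ _ _ _ _ _ _ _ => rfl)
    (fun L _ _ _ _ w hw _ hϖ => isLocSmooth_pieceTransvMinus L w hw hϖ)
    (fun L _ _ _ _ w hw _ hϖ _ hk x => (pieces_conj_eq L w hw hϖ hk x).2.1)
    (fun L _ _ _ v w hw _ hϖ0 T _ hx => transvMinus_profile_conj_iff (galAdicCompletionMap (L := L) (IsCMField.complexConj L) hw) hϖ0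
      (dOfPlace L v w) (dOfPlace L v w % 2) (mstarFn L v w) T hx)

/-- **`PieceCountDictionary pieceReg cntReg`** (pays `U2G_Census.stub_U2G_dict_reg` BY NAME): `Φ(⟦γ⟧, f_reg; mG₃) = νG₃(K).toReal · regFixCount σ_w ϖ m* (ι_w γ)` —
the regular-profile piece counts the type-0 vertices `M` fixed by `ι_w γ` with `(ι_w γ − 1)²·M ⊄ ϖ^{m*}·M`.
[cite: Kottwitz1986BaseChangeUnits, §1 pp. 240–241, §3] [cite: Rogawski1990, §4.9 Prop. 4.9.1 (b) p. 55] [cite: Laumon1995, Lemma (5.3.2) p. 136] -/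
theorem pieceCountDictionary_reg : PieceCountDictionary pieceReg cntReg :=
  pieceCountDictionary_of_profile
    (fun L _ _ _ v w _ ϖ X => ¬ InLevel ϖ (mstarFn L v w) (X * X))
    (fun L _ _ _ v w _ ϖ X M => ¬ LatticeInLevel ϖ (mstarFn L v w) (X * X) M)
    pieceReg cntReg (fun _ _ _ _ _ _ _ _ => rfl) (fun _ _ _ _ _ _ _ _ _ => rfl)
    (fun L _ _ _ _ w hw _ hϖ => isLocSmooth_pieceReg L w hw hϖ)
    (fun L _ _ _ _ w hw _ hϖ _ hk x => (pieces_conj_eq L w hw hϖ hk x).2.2)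
    (fun L _ _ _ v w _ _ hϖ0 T x _ => reg_profile_conj_iff hϖ0 (mstarFn L v w) T x)

end Summit.HodgeConjecture.HodgeConjecture.Cruxes.H413.F0P3cDyRamPieceCountDictionaryProfiles

end
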